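import Summits.CriticalPhenomena.PercolationContinuityZ3.Theorems.PercNearOneGluingNoHeavyQuantIndepBlobThreeBlobs
import Summits.CriticalPhenomena.PercolationContinuityZ3.Theorems.PercNearOneGluingNoHeavyQuantFSEConcordance
import HarnessLib

/-!
# QUANT lane R8, Conjecture DIB\* — CONJECTURE FS-E HOLDS ON EVERY HARD INSTANCE WITH AT MOST THREE NON-EMPTY BLOBS (kernel): the one-split
# certificate (open branch ∨, closed branch ∧) is exact there, for EVERY choice of the split blob

builds on p205010 (kernel theorem, internal audit signed; external expert review pending)

Support file (`--supports stmt-CriticalPhenomena-4575`), QUANT lane typer seat prim-quant-stmt (gen 20), rung R8 of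
`run/shared/lean/prim/quant/LADDER.md`.  Theorems only (no definitions, no sorries, standard axioms).  Companion of `…QuantIndepBlobThreeBlobs`
(same seat: the real inequality `two_of_three_ge_floor`, the TRIPLE certificate, DIB\* for `≤ 3` non-empty blobs) and of the typed conjectures
`Quant.IndepBlob.FSE` (lead g17, `…QuantDIBStarFSE`), `StepFSE` / `StepFSEMax` (typer g19, `…QuantStepFSE`), concordance `…QuantFSEConcordance`.

The lead's observation (LEAD-NOTES-G17 N33 (4)(iii): "the tight family passes with margin — the step is exact on 3-blob systems") as a theorem.
For three distinct blobs `k, l, m`, pairwise completing (`j + 1 ≤ a k + a l`, …), split on `k` (rule φ): the OPEN branch (sure part `a k`) is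
certified by ∨ with the giants `{l, m}` at `z₁ = 1 − (1 − g l)(1 − g m)`, the CLOSED branch by ∧ with the witness set `{l, m}` at `z₀ = g l·g m`, and
`g k·z₁ + (1 − g k)·z₀ = P(at least two of k, l, m open) ≥ x` is `two_of_three_ge_floor` once the three credit rates sum to `≥ 2`.

* `Quant.IndepBlob.fsMenuE_open_pair`, `fsMenuE_closed_pair` — the two menu-E certificates (items ∨ and ∧ of `RootDec.FSMenuE`).
* `Quant.IndepBlob.stepCert_of_triple` — for pairwise-completing `k, l, m` with rates `≥ 2` and `1/2 ≤ x < 1`: `∃ z₁ z₀, x ≤ g k·z₁ + (1 − g k)·z₀`,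
  both branches `FSMenuE`-certified (split on `k`; by symmetry on any of the three).
* `Quant.IndepBlob.exists_triple_of_card_le_three` — sizes `≤ j`, credit `> 2j`, `#{k : 0 < a k} ≤ 3`, `x < 1` ⟹ the non-empty blobs are exactly three,
  pairwise completing, with rates summing to `≥ 2` (the combinatorial half of `tail_ge_of_card_le_three`, isolated).
* **`Quant.IndepBlob.stepFSE_of_card_le_three`** — on such an instance EVERY non-empty blob `k` admits the certificate pair (so in particular the
  lead's rule MAXSIZE does): the conclusion of `StepFSE` / `StepFSEMax` with no corner hypothesis other than sizes `≤ j`.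
* **`Quant.IndepBlob.fse_of_card_le_three`**, **`stepFSEMax_of_card_le_three`** — the conjectures of record `FSE` (lead) and `StepFSEMax` (the tested
  rule) RESTRICTED to instances with at most three non-empty blobs, in their exact binder shapes plus `#{k : 0 < a k} ≤ 3` — kernel theorems.

[this work]; the gluing rows served [cite: KozmaNitzan2024, Conjecture 3 (p. 15)]; product weights [cite: Grimmett1999, §1.3 p. 10].
-/

namespace Summit.CriticalPhenomena.PercolationContinuityZ3.Theorems

namespace Quant

namespace IndepBlob

open Finset

variable {κ : Type} [Fintype κ] [DecidableEq κ]

/-! ### 1. The two branch certificates of the split on one of three pairwise-completing blobs -/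

/-- **Open branch, item ∨.**  Split on `k`; the blobs `l, m` complete `k` (`j + 1 ≤ a k + a l`, `j + 1 ≤ a k + a m`): the open branch (sure part
`a k`, system `a[k ↦ 0]`) is `FSMenuE`-certified at `1 − (1 − g l)(1 − g m)`. [this work] -/
theorem fsMenuE_open_pair (a : κ → ℕ) (g : κ → ℝ) (j : ℕ) (k l m : κ) (hkl : k ≠ l) (hkm : k ≠ m) (hlm : l ≠ m)
    (hkl' : j + 1 ≤ a k + a l) (hkm' : j + 1 ≤ a k + a m) :
    RootDec.FSMenuE (1 - (1 - g l) * (1 - g m)) (a k) (Function.update a k 0) g j := by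
  refine Or.inr (Or.inr (Or.inr (Or.inl ⟨{l, m}, fun i hi => ?_, ?_⟩)))
  · rcases Finset.mem_insert.1 hi with rfl | hi
    · rw [Function.update_of_ne hkl.symm]; exact hkl'
    · rw [Finset.mem_singleton.1 hi, Function.update_of_ne hkm.symm]; exact hkm'
  · rw [Finset.prod_pair hlm]

/-- **Closed branch, item ∧.**  Split on `k`; the blobs `l, m` complete each other (`j + 1 ≤ a l + a m`): the closed branch (sure part `0`,
system `a[k ↦ 0]`) is `FSMenuE`-certified at `g l·g m`. [this work] -/
theorem fsMenuE_closed_pair (a : κ → ℕ) (g : κ → ℝ) (j : ℕ) (k l m : κ) (hkl : k ≠ l) (hkm : k ≠ m) (hlm : l ≠ m)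
    (hlm' : j + 1 ≤ a l + a m) :
    RootDec.FSMenuE (g l * g m) 0 (Function.update a k 0) g j := by
  refine Or.inr (Or.inr (Or.inr (Or.inr (Or.inl ⟨{l, m}, ?_, ?_⟩))))
  · rw [Finset.sum_pair hlm, Function.update_of_ne hkl.symm, Function.update_of_ne hkm.symm]; omega
  · rw [Finset.prod_pair hlm]

/-- **The one-split certificate on a pairwise-completing triple.**  Gates in `[0,1]`, `1/2 ≤ x < 1`, `k, l, m` distinct and pairwise completing,
credit rates (`g` if `x ≤ g`, else `(g − x²)/(1 − x)`) summing to `≥ 2` ⟹ `∃ z₁ z₀, x ≤ g k·z₁ + (1 − g k)·z₀` with both branches of the split on `k`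
menu-E certified (∨ / ∧; the convex combination is `P(≥ 2 of the three open) ≥ x`, `two_of_three_ge_floor`). [this work] -/
theorem stepCert_of_triple (a : κ → ℕ) (g : κ → ℝ) (j : ℕ) (hg : ∀ i, 0 ≤ g i ∧ g i ≤ 1) (k l m : κ)
    (hkl : k ≠ l) (hkm : k ≠ m) (hlm : l ≠ m)
    (hkl' : j + 1 ≤ a k + a l) (hkm' : j + 1 ≤ a k + a m) (hlm' : j + 1 ≤ a l + a m)
    (x : ℝ) (hx : 1 / 2 ≤ x) (hx1 : x < 1)
    (hcr : 2 ≤ (if x ≤ g k then g k else (g k - x ^ 2) / (1 - x)) + (if x ≤ g l then g l else (g l - x ^ 2) / (1 - x)) +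
      (if x ≤ g m then g m else (g m - x ^ 2) / (1 - x))) :
    ∃ z₁ z₀ : ℝ, x ≤ g k * z₁ + (1 - g k) * z₀ ∧
      RootDec.FSMenuE z₁ (a k) (Function.update a k 0) g j ∧ RootDec.FSMenuE z₀ 0 (Function.update a k 0) g j := by
  refine ⟨1 - (1 - g l) * (1 - g m), g l * g m, ?_, fsMenuE_open_pair a g j k l m hkl hkm hlm hkl' hkm',
    fsMenuE_closed_pair a g j k l m hkl hkm hlm hlm'⟩
  have h := two_of_three_ge_floor x (g k) (g l) (g m) hx hx1 (hg k) (hg l) (hg m) hcr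
  have hid : g k * (1 - (1 - g l) * (1 - g m)) + (1 - g k) * (g l * g m) =
      g k * g l + g k * g m + g l * g m - 2 * g k * g l * g m := by ring
  linarith

/-! ### 2. Instances with at most three non-empty blobs -/

/-- **The combinatorial half.**  Gates in `[0,1]`, `x < 1`, all sizes `≤ j`, credit `Σ a k·φ_x(g k) > 2j`, at most three non-empty blobs ⟹ the
non-empty blobs are exactly three, `k₁, k₂, k₃`, pairwise completing, with `φ_x(g k₁) + φ_x(g k₂) + φ_x(g k₃) ≥ 2`. [this work] -/
theorem exists_triple_of_card_le_three (x : ℝ) (hx1 : x < 1) (a : κ → ℕ) (g : κ → ℝ) (j : ℕ) (hg : ∀ k, 0 ≤ g k ∧ g k ≤ 1)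
    (hsize : ∀ k, a k ≤ j)
    (hcredit : (2 * j : ℝ) < ∑ k, (a k : ℝ) * (if x ≤ g k then g k else (g k - x ^ 2) / (1 - x)))
    (hcard : (Finset.univ.filter (fun k => 0 < a k)).card ≤ 3) :
    ∃ k₁ k₂ k₃ : κ, k₁ ≠ k₂ ∧ k₁ ≠ k₃ ∧ k₂ ≠ k₃ ∧ Finset.univ.filter (fun k => 0 < a k) = {k₁, k₂, k₃} ∧
      j + 1 ≤ a k₁ + a k₂ ∧ j + 1 ≤ a k₁ + a k₃ ∧ j + 1 ≤ a k₂ + a k₃ ∧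
      2 ≤ (if x ≤ g k₁ then g k₁ else (g k₁ - x ^ 2) / (1 - x)) + (if x ≤ g k₂ then g k₂ else (g k₂ - x ^ 2) / (1 - x)) +
        (if x ≤ g k₃ then g k₃ else (g k₃ - x ^ 2) / (1 - x)) := by
  set φ : κ → ℝ := fun k => if x ≤ g k then g k else (g k - x ^ 2) / (1 - x) with hφ
  have hφ1 : ∀ k, φ k ≤ 1 := fun k => creditRate_le_one x (g k) hx1 (hg k).2
  have hterm1 : ∀ k, (a k : ℝ) * φ k ≤ a k := fun k => mul_le_of_le_one_right (Nat.cast_nonneg _) (hφ1 k)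
  have haj : ∀ k, (a k : ℝ) ≤ j := fun k => by exact_mod_cast hsize k
  have hterm : ∀ k, (a k : ℝ) * φ k ≤ j := fun k => (hterm1 k).trans (haj k)
  set T := Finset.univ.filter (fun k => 0 < a k) with hTdef
  have hsumT : ∑ k, (a k : ℝ) * φ k = ∑ k ∈ T, (a k : ℝ) * φ k := by
    refine (Finset.sum_subset (Finset.filter_subset _ _) fun k _ hk => ?_).symm
    have hk0 : a k = 0 := by
      have : ¬ 0 < a k := fun h => hk (Finset.mem_filter.2 ⟨Finset.mem_univ k, h⟩)
      omega
    rw [hk0, Nat.cast_zero, zero_mul]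
  have hcreditT : (2 * j : ℝ) < ∑ k ∈ T, (a k : ℝ) * φ k := by rw [← hsumT]; exact hcredit
  have hcard3 : T.card = 3 := by
    refine le_antisymm hcard ?_
    by_contra hlt
    have hle2 : (T.card : ℝ) ≤ 2 := by exact_mod_cast (show T.card ≤ 2 by omega)
    have hbound : ∑ k ∈ T, (a k : ℝ) * φ k ≤ T.card • (j : ℝ) := Finset.sum_le_card_nsmul T _ _ fun k _ => hterm k
    rw [nsmul_eq_mul] at hbound
    have hj0 : (0 : ℝ) ≤ j := Nat.cast_nonneg j
    nlinarith
  obtain ⟨k₁, k₂, k₃, h12, h13, h23, hT3⟩ := Finset.card_eq_three.1 hcard3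
  have hsum3 : ∑ k ∈ T, (a k : ℝ) * φ k = (a k₁ : ℝ) * φ k₁ + ((a k₂ : ℝ) * φ k₂ + (a k₃ : ℝ) * φ k₃) := by
    rw [hT3, Finset.sum_insert (by simp [h12, h13]), Finset.sum_insert (by simp [h23]), Finset.sum_singleton]
  rw [hsum3] at hcreditT
  have hpos₁ : 0 < a k₁ := (Finset.mem_filter.1 (hT3 ▸ by simp : k₁ ∈ T)).2
  have hjpos : (0 : ℝ) < j := by exact_mod_cast (lt_of_lt_of_le hpos₁ (hsize k₁))
  have hφpos : ∀ k k' k'' : κ, (2 * j : ℝ) < (a k : ℝ) * φ k + ((a k' : ℝ) * φ k' + (a k'' : ℝ) * φ k'') → 0 ≤ φ k := by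
    intro k k' k'' h
    by_contra hneg
    have hφk : φ k ≤ 0 := (not_le.1 hneg).le
    have h0 : (a k : ℝ) * φ k ≤ 0 := mul_nonpos_iff.2 (Or.inl ⟨Nat.cast_nonneg _, hφk⟩)
    linarith [hterm k', hterm k'']
  have hφ₁ : 0 ≤ φ k₁ := hφpos k₁ k₂ k₃ hcreditT
  have hφ₂ : 0 ≤ φ k₂ := hφpos k₂ k₁ k₃ (by linarith)
  have hφ₃ : 0 ≤ φ k₃ := hφpos k₃ k₁ k₂ (by linarith)
  have hp12 : j + 1 ≤ a k₁ + a k₂ := by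
    have h : (j : ℝ) < a k₁ + a k₂ := by linarith [hterm1 k₁, hterm1 k₂, hterm k₃]
    have h' : j < a k₁ + a k₂ := by exact_mod_cast h
    omega
  have hp13 : j + 1 ≤ a k₁ + a k₃ := by
    have h : (j : ℝ) < a k₁ + a k₃ := by linarith [hterm1 k₁, hterm1 k₃, hterm k₂]
    have h' : j < a k₁ + a k₃ := by exact_mod_cast h
    omega
  have hp23 : j + 1 ≤ a k₂ + a k₃ := by
    have h : (j : ℝ) < a k₂ + a k₃ := by linarith [hterm1 k₂, hterm1 k₃, hterm k₁]
    have h' : j < a k₂ + a k₃ := by exact_mod_cast h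
    omega
  have hcr : 2 ≤ φ k₁ + φ k₂ + φ k₃ := by
    have h : (j : ℝ) * 2 < j * (φ k₁ + φ k₂ + φ k₃) := by
      nlinarith [mul_nonneg (sub_nonneg.2 (haj k₁)) hφ₁, mul_nonneg (sub_nonneg.2 (haj k₂)) hφ₂,
        mul_nonneg (sub_nonneg.2 (haj k₃)) hφ₃]
    exact (lt_of_mul_lt_mul_left h hjpos.le).le
  exact ⟨k₁, k₂, k₃, h12, h13, h23, hT3, hp12, hp13, hp23, hcr⟩

/-- **FS-E's certificates exist for EVERY non-empty blob of a hard instance with at most three non-empty blobs.**  Gates in `[0,1]`,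
`1/2 ≤ x < 1`, all sizes `≤ j`, credit `> 2j`, `#{k : 0 < a k} ≤ 3` ⟹ for every `k` with `0 < a k` there are `z₁, z₀` with
`x ≤ g k·z₁ + (1 − g k)·z₀`, `FSMenuE z₁ (a k) a[k↦0] g j` and `FSMenuE z₀ 0 a[k↦0] g j`. [this work] -/
theorem stepFSE_of_card_le_three (x : ℝ) (hx : 1 / 2 ≤ x) (hx1 : x < 1) (a : κ → ℕ) (g : κ → ℝ) (j : ℕ)
    (hg : ∀ k, 0 ≤ g k ∧ g k ≤ 1) (hsize : ∀ k, a k ≤ j)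
    (hcredit : (2 * j : ℝ) < ∑ k, (a k : ℝ) * (if x ≤ g k then g k else (g k - x ^ 2) / (1 - x)))
    (hcard : (Finset.univ.filter (fun k => 0 < a k)).card ≤ 3) (k : κ) (hk : 0 < a k) :
    ∃ z₁ z₀ : ℝ, x ≤ g k * z₁ + (1 - g k) * z₀ ∧
      RootDec.FSMenuE z₁ (a k) (Function.update a k 0) g j ∧ RootDec.FSMenuE z₀ 0 (Function.update a k 0) g j := by
  obtain ⟨k₁, k₂, k₃, h12, h13, h23, hT3, hp12, hp13, hp23, hcr⟩ :=
    exists_triple_of_card_le_three x hx1 a g j hg hsize hcredit hcard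
  have hkT : k ∈ ({k₁, k₂, k₃} : Finset κ) := hT3 ▸ Finset.mem_filter.2 ⟨Finset.mem_univ k, hk⟩
  rcases Finset.mem_insert.1 hkT with rfl | hkT
  · exact stepCert_of_triple a g j hg k k₂ k₃ h12 h13 h23 hp12 hp13 hp23 x hx hx1 hcr
  rcases Finset.mem_insert.1 hkT with rfl | hkT
  · exact stepCert_of_triple a g j hg k k₁ k₃ h12.symm h23 h13 (by omega) hp23 hp13 x hx hx1 (by linarith)
  · rw [Finset.mem_singleton.1 hkT]
    exact stepCert_of_triple a g j hg k₃ k₁ k₂ h13.symm h23.symm h12 (by omega) (by omega) hp12 x hx hx1 (by linarith)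

/-! ### 3. The conjectures of record, restricted to at most three non-empty blobs -/

/-- **`StepFSEMax` on instances with at most three non-empty blobs** (its binder shape verbatim, plus `#{k : 0 < a k} ≤ 3`): the lead's rule —
every blob of maximal size and, among those, maximal gate — admits the certificate pair (indeed every non-empty blob does). [this work] -/
theorem stepFSEMax_of_card_le_three (a : κ → ℕ) (g : κ → ℝ) (j : ℕ) (x : ℝ)
    (hx : 1 / 2 < x) (hx1 : x < 1) (hg : ∀ k, 0 ≤ g k ∧ g k ≤ 1) (hlight : ∀ k, g k < x → a k ≤ j)
    (_hcorner : ∑ k ∈ Finset.univ.filter (fun k => x ≤ g k), a k ≤ 2 * j) (hnogiant : ∀ k, x ≤ g k → a k ≤ j)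
    (htwo : ∃ k₁ k₂, k₁ ≠ k₂ ∧ g k₁ < x ∧ 0 < a k₁ ∧ g k₂ < x ∧ 0 < a k₂)
    (hcredit : (2 * j : ℝ) < ∑ k, (a k : ℝ) * (if x ≤ g k then g k else (g k - x ^ 2) / (1 - x)))
    (hcard : (Finset.univ.filter (fun k => 0 < a k)).card ≤ 3)
    (k : κ) (hmax : ∀ i, a i ≤ a k) (_hgate : ∀ i, a i = a k → g i ≤ g k) :
    ∃ z₁ z₀ : ℝ, x ≤ g k * z₁ + (1 - g k) * z₀ ∧
      RootDec.FSMenuE z₁ (a k) (Function.update a k 0) g j ∧ RootDec.FSMenuE z₀ 0 (Function.update a k 0) g j := by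
  have hsize : ∀ i, a i ≤ j := fun i => by
    by_cases h : g i < x
    · exact hlight i h
    · exact hnogiant i (not_lt.1 h)
  obtain ⟨k₁, _, _, _, hk₁, _, _⟩ := htwo
  exact stepFSE_of_card_le_three x hx.le hx1 a g j hg hsize hcredit hcard k (lt_of_lt_of_le hk₁ (hmax k₁))

/-- **`FSE` (the lead's conjecture of record) on instances with at most three non-empty blobs** (its binder shape verbatim, plus
`#{k : 0 < a k} ≤ 3`): some blob — in fact any non-empty one — splits the instance with `CertFS`-certified branches. [this work] -/
theorem fse_of_card_le_three (a : κ → ℕ) (g : κ → ℝ) (j : ℕ) (x : ℝ)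
    (hx : 1 / 2 < x) (hx1 : x < 1) (hg : ∀ k, 0 ≤ g k ∧ g k ≤ 1) (hlight : ∀ k, g k < x → a k ≤ j)
    (_hcorner : ∑ k ∈ Finset.univ.filter (fun k => x ≤ g k), a k ≤ 2 * j) (hnogiant : ∀ k, x ≤ g k → a k ≤ j)
    (htwo : ∃ k₁ k₂, k₁ ≠ k₂ ∧ g k₁ < x ∧ 0 < a k₁ ∧ g k₂ < x ∧ 0 < a k₂)
    (_hbig : j + 1 ≤ ∑ k ∈ Finset.univ.filter (fun k => g k < x), a k)
    (hcredit : (2 * j : ℝ) < ∑ k, (a k : ℝ) * (if x ≤ g k then g k else (g k - x ^ 2) / (1 - x)))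
    (hcard : (Finset.univ.filter (fun k => 0 < a k)).card ≤ 3) :
    ∃ k : κ, ∃ z₁ z₀ : ℝ, x ≤ g k * z₁ + (1 - g k) * z₀ ∧
      RootDec.CertFS (Function.update a k 0) g j (a k) z₁ ∧ RootDec.CertFS (Function.update a k 0) g j 0 z₀ := by
  have hsize : ∀ i, a i ≤ j := fun i => by
    by_cases h : g i < x
    · exact hlight i h
    · exact hnogiant i (not_lt.1 h)
  obtain ⟨k₁, _, _, _, hk₁, _, _⟩ := htwo
  obtain ⟨z₁, z₀, hconv, h₁, h₀⟩ := stepFSE_of_card_le_three x hx.le hx1 a g j hg hsize hcredit hcard k₁ hk₁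
  exact ⟨k₁, z₁, z₀, hconv, RootDec.certFS_of_fsMenuE _ g j _ z₁ h₁, RootDec.certFS_of_fsMenuE _ g j _ z₀ h₀⟩

end IndepBlob

end Quant

end Summit.CriticalPhenomena.PercolationContinuityZ3.Theorems
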